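import Summits.HodgeConjecture.HodgeConjecture.Theorems.R90S9SignedLetterCongrTransport      -- ★ p861691 (this seat): `smoothTrace_comap_map_symm`; brings ★ `F0P3cStCharTSOfQuasiSplit` (frame-transport vocabulary), ★ `FinExplicitTransferFactorFormTransport`
import Summits.HodgeConjecture.HodgeConjecture.Theorems.R90S9SimilCongrLocalConstituents      -- ★ p861492 (R90-IF-p02): `cmSplitPacket`, `cmSplitEquiv`, `localGLPiEquiv`, `IrrClass.comap_eq_comap_of_forall_eq_conj`
import HarnessLib

/-!
# R90-TF · S9 «InnerForm-13.3.6 (c)» — (B3d, d3-split) THE SPLIT-PLACE LETTER [13.1.4 ∕ 4.13.1 (b)] RIDES A FORM CONGRUENCE TO THE QUASI-SPLIT MODEL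

Cell `hodgecm-mathlib`, crux H413 (`stmt-HodgeConjecture-24833`, lane `--supports`), route of record `HCCMUnconditional` (no route verbs; count-neutral).  Programme
R90-TF (brief `director/R90-BRIEF.v2.md` 1f40d54518340a35), section S9 (base `R90-IF`); seat R90-IF-p03 (g0), RE-DEAL «B3d» (R90-IF-plan (g0), `R90/STATUS.md`
2026-09-04T15:43:02Z), census `R90/R90-IF-p03/g0/CENSUS-B3d.md` item (d3-split).  THEOREMS ONLY, sorry-free, over ★ currency.  HONEST LABEL: HC_CM is proved only modulo the
7 printed citations (2 remaining named inputs: hLiu418 = stmt-HodgeConjecture-24832, h413 = stmt-HodgeConjecture-24833) until rung 0 closes; this file proves no printed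
statement — it is the split-place half of the transport of print's pinned data from `U(H)` to `U(Φ₃)`.

THE MATHEMATICS.  At a place `v` of `L⁺` SPLIT in `L` (two places `w ≠ w̄` above `v`) Rogawski's explicit factor `Δ‴_v(γ_H, γ′) = [ι(γ_H) ↔ γ′]·τ_v·D_v·κ_v` has
`κ_v = +1` on its support (★ `finKappaAt_of_not_subsingleton`: «it is `+1` for almost all `v`», [Rogawski1990 §14.6 p. 242]), so for a frame `ᵗ(σT)·H_v·T = a·Φ₃`
(`e := cmDatumLocalCongr L v T ha h : U(Φ₃)_v ≃ₜ* U(H)_v`) the factor is INVARIANT: `Δ‴_v^{Φ₃}(γ_H, e⁻¹γ′) = Δ‴_v^{H}(γ_H, γ′)` for `G`-regular `γ_H` (§1; the matching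
pairs correspond along the class-preserving `e`, ★ `isLocalNormPair_iff_comp_of_corresponds`, and the support condition `P_v ≠ 0` holds on both sides, ★
`finEigenlineProjector_ne_zero_of_isUnit`) — no sign, in contrast with the non-split law ★ `finExplicitDelta_cmDatumLocalCongr_symm` (`χ(a)`).  Hence the `Δ‴`-weighted
orbital sums and the matching relation (4.3.1) transport along `e` WITHOUT a factor (§2, §3: reindex the classes, ★ `classOrbitalIntegral_transport`), and the split letter —
`Π(ξ_v) = {i_G(ξ_w)}` (★ `cmSplitPacket`), `Tr i_G(ξ_w)(f) = ∫ ξ_v f^H` for `Δ‴`-matched test pairs [Lemma 4.13.1 (b)] — rides to the model: the split packet of `U(H)_v`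
pulled back along `e` IS the split packet of `U(Φ₃)_v` (§4, the two identifications with `GL₃(L_w)` differ by the inner automorphism `Ad(T_w)`, as in ★ p02
`cmSplitPacket_map_comap_cmDatumLocalCongr_symm`), and characters transport (★ «TR», every class admissible ★ `localIrrepAdmissible_three_all`).

* §1 `finExplicitDelta_cmDatumLocalCongr_symm_of_split` — `Δ‴_v^{Φ₃}(γ_H, e⁻¹γ′) = Δ‴_v^{H}(γ_H, γ′)` at a split `v`.
* §2 `finsum_finExplicitDelta_mul_classOrbitalIntegral_transport_of_split`; §3 `isLocalDeltaTransfer_iff_of_formCongr_of_split` — (4.3.1) across the frame, no factor.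
* §4 `cmSplitPacket_map_comap_cmDatumLocalCongr`, `charIdentityAtTest_single_transport_formCongr_of_split`, **`cmSplitCharIdentityAtTest_transport_formCongr`** — the split
  conjunct of the Q-package for `H` at `D` implies the split conjunct for `Φ₃` at `D₀ = (Δ‴_{Φ₃}, m_H, e⁻¹_* m_G, e⁻¹_* ν_G, ν_H)`.

## References
* [Rogawski1990] J. D. Rogawski, *Automorphic Representations of Unitary Groups in Three Variables*, Ann. of Math. Stud. 123 (1990): §4.3 (4.3.1) p. 43; §4.9 p. 55;
  §4.13 Lemma 4.13.1 (b) p. 63; §13.1 Prop. 13.1.4 p. 199; §13.3 p. 201; §14.2 pp. 232–234; §14.6 p. 242.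
* [LanglandsShelstad1987] R. P. Langlands, D. Shelstad, *On the definition of transfer factors*, Math. Ann. 278 (1987): §1.
-/

set_option autoImplicit false
-- the mandated namespace repeats `HodgeConjecture.HodgeConjecture`, as in every `Theorems/*.lean` of this sub-problem
set_option linter.dupNamespace false

noncomputable section

open NumberField IsDedekindDomain MeasureTheory MeasureTheory.Measure
open scoped Matrix MatrixGroups
open Literature.NumberTheory.Rogawski1990 Literature.NumberTheory.Automorphic Literature.NumberTheory.Automorphic.UnitaryGroup
open Literature.NumberTheory.GaloisRepresentations
open Summit.HodgeConjecture.HodgeConjecture.Cruxes.H413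

namespace Summit.HodgeConjecture.HodgeConjecture.R90.S9

section Split

variable (L : Type) [Field L] [NumberField L] [IsCMField L] (H : Matrix (Fin 3) (Fin 3) L)
  (v : HeightOneSpectrum (𝓞 ↥(maximalRealSubfield L)))
  (T : GL (Fin 3) (UnitaryGroup.LocalRing L v)) {a : UnitaryGroup.LocalRing L v} (ha : IsUnit a)
  (h : formCongr (conjLocal L (IsCMField.complexConj L) v) T (H.map (algebraMap L (UnitaryGroup.LocalRing L v))) =
    a • (Matrix.of fun i j : Fin 3 => if i.val + j.val + 1 = 3 then (1 : L) else 0).map (algebraMap L (UnitaryGroup.LocalRing L v)))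

/-- At a split `v` there are two places above `v`, so `PlacesOver L v` is not a subsingleton (★ `PlacesOver.galInv_ne`). [cite: Rogawski1990, §14.6 p. 242] -/
theorem not_subsingleton_placesOver_of_split (hs : ∃ w : PlacesOver L v, IsCMField.complexConj L • w.1 ≠ w.1) : ¬ Subsingleton (PlacesOver L v) := by
  obtain ⟨w, hw⟩ := hs
  exact fun _ => PlacesOver.galInv_ne (IsCMField.complexConj L) w hw (Subsingleton.elim _ _)

/-! ## §1 `Δ‴_v` across the frame at a split place: no sign -/

include h in
open scoped Classical in
/-- **`Δ‴_v^{Φ₃}(γ_H, e⁻¹γ′) = Δ‴_v^{H}(γ_H, γ′)` AT A SPLIT `v`** for `γ_H` with `χ_g(u)` a unit (every `G`-regular `γ_H`) and every `γ′ ∈ U(H)_v`: the matching pairs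
correspond along the class-preserving `e` (★ `corresponds_cmDatumLocalCongr_symm`, ★ `isLocalNormPair_iff_comp_of_corresponds`); on them `τ_v`, `D_v` see `γ_H` only and
`κ_v = 1` on BOTH sides (two places above `v`: ★ `finKappaAt_of_not_subsingleton`, support ★ `finEigenlineProjector_ne_zero_of_isUnit`); off them both vanish.
[cite: Rogawski1990, §4.9 p. 55; §14.6 p. 242; §4.3 p. 43] [cite: LanglandsShelstad1987, §1] -/
theorem finExplicitDelta_cmDatumLocalCongr_symm_of_split (hs : ∃ w : PlacesOver L v, IsCMField.complexConj L • w.1 ≠ w.1) (μ : HeckeCharacter L)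
    (γH : (UnitaryGroup.cmDatum L 2 (Matrix.of fun i j : Fin 2 => if i.val + j.val + 1 = 2 then (1 : L) else 0)).Local v ×
      (UnitaryGroup.cmDatum L 1 (Matrix.of fun i j : Fin 1 => if i.val + j.val + 1 = 1 then (1 : L) else 0)).Local v)
    (hu : IsUnit ((finCharpolyTwo L v γH).eval (finGammaTwo L v γH))) (b : (UnitaryGroup.cmDatum L 3 H).Local v) :
    finExplicitDelta L v (Matrix.of fun i j : Fin 3 => if i.val + j.val + 1 = 3 then (1 : L) else 0) γH μ ((cmDatumLocalCongr L v T ha h).symm b) =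
      finExplicitDelta L v H γH μ b := by
  classical
  have hns := not_subsingleton_placesOver_of_split L v hs
  have hcl : ∀ γ' : (UnitaryGroup.cmDatum L 3 H).Local v,
      Corresponds (UnitaryGroup.conjLocal L (IsCMField.complexConj L) v) ((UnitaryGroup.adelicForm L 3 H).map (UnitaryGroup.adeleToLocal L v))
        ((UnitaryGroup.adelicForm L 3 (Matrix.of fun i j : Fin 3 => if i.val + j.val + 1 = 3 then (1 : L) else 0)).map (UnitaryGroup.adeleToLocal L v))
        γ' ((cmDatumLocalCongr L v T ha h).symm γ') :=
    fun γ' => corresponds_comm.1 (corresponds_cmDatumLocalCongr_symm L v T ha h γ')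
  by_cases hb : IsLocalNormPair L H v γH b
  · have hb₀ : IsLocalNormPair L (Matrix.of fun i j : Fin 3 => if i.val + j.val + 1 = 3 then (1 : L) else 0) v γH
        ((cmDatumLocalCongr L v T ha h).symm b) :=
      (isLocalNormPair_iff_comp_of_corresponds L H v (cmDatumLocalCongr L v T ha h).symm hcl γH b).1 hb
    rw [finExplicitDelta_of_isLocalNormPair L v _ γH μ hb₀, finExplicitDelta_of_isLocalNormPair L v H γH μ hb,
      finKappaAt_of_not_subsingleton L v _ γH (finEigenlineProjector_ne_zero_of_isUnit L v _ γH _ hb₀ hu) hns,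
      finKappaAt_of_not_subsingleton L v H γH (finEigenlineProjector_ne_zero_of_isUnit L v H γH b hb hu) hns]
  · have hb₀ : ¬ IsLocalNormPair L (Matrix.of fun i j : Fin 3 => if i.val + j.val + 1 = 3 then (1 : L) else 0) v γH
        ((cmDatumLocalCongr L v T ha h).symm b) :=
      fun h0 => hb ((isLocalNormPair_iff_comp_of_corresponds L H v (cmDatumLocalCongr L v T ha h).symm hcl γH b).2 h0)
    rw [finExplicitDelta_of_not_isLocalNormPair L v _ γH μ hb₀, finExplicitDelta_of_not_isLocalNormPair L v H γH μ hb]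

/-! ## §1b The split packet rides the frame (class level) -/

/-- **The split packet of `U(H)_v` pulled back along `e` IS the split packet of `U(Φ₃)_v`** (same `w`, same labels `ν₀, χ′`): the identifications `s_H ∘ e` and `s_{Φ₃}` of
`U(Φ₃)_v` with `GL₃(L_w)` differ by the inner automorphism `Ad(T_w)` (★ `localGLPiEquiv` is multiplicative), and inner automorphisms fix classes (★
`IrrClass.comap_eq_comap_of_forall_eq_conj`).  The frame-shape twin of ★ p02 `cmSplitPacket_map_comap_cmDatumLocalCongr_symm`.
[cite: Rogawski1990, §14.2 p. 234; §4.13 p. 62; §13.3 p. 201] -/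
theorem cmSplitPacket_map_comap_cmDatumLocalCongr (hH : (H.map (cmConjRingHom L))ᵀ = H) (hHd : IsUnit H.det)
    (w : PlacesOver L v) (hw : IsCMField.complexConj L • w.1 ≠ w.1)
    [LocallyCompactSpace (standardParabolicGL (w.1.adicCompletion L) (Zelevinsky1980.lastBlockLabel 3))]
    (ν₀ χ' : (w.1.adicCompletion L)ˣ →* ℂˣ) (hν₀u : ∀ x, ‖((ν₀ x : ℂˣ) : ℂ)‖ = 1)
    (hν₀c : Continuous fun x => ((ν₀ x : ℂˣ) : ℂ)) (hχ'u : ∀ x, ‖((χ' x : ℂˣ) : ℂ)‖ = 1)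
    (hχ'c : Continuous fun x => ((χ' x : ℂˣ) : ℂ)) :
    (cmSplitPacket L H hH hHd v w hw ν₀ χ' hν₀u hν₀c hχ'u hχ'c).map (IrrClass.comap (cmDatumLocalCongr L v T ha h)) =
      cmSplitPacket L (Matrix.of fun i j : Fin 3 => if i.val + j.val + 1 = 3 then (1 : L) else 0) (antidiagOne_isHermitian L 3) (isUnit_antidiagOne_det L 3)
        v w hw ν₀ χ' hν₀u hν₀c hχ'u hχ'c := by
  refine LocalAPacket.ext' ?_ rfl
  change IrrClass.comap (cmDatumLocalCongr L v T ha h)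
      (IrrClass.comap (cmSplitEquiv L H hH hHd v w hw)
        (IrrClass.mk (splitMemberGL (w.1.adicCompletion L) ν₀ χ' hν₀u hν₀c hχ'u hχ'c))) =
    IrrClass.comap (cmSplitEquiv L (Matrix.of fun i j : Fin 3 => if i.val + j.val + 1 = 3 then (1 : L) else 0) (antidiagOne_isHermitian L 3)
        (isUnit_antidiagOne_det L 3) v w hw)
      (IrrClass.mk (splitMemberGL (w.1.adicCompletion L) ν₀ χ' hν₀u hν₀c hχ'u hχ'c))
  rw [IrrClass.comap_comap]
  refine (IrrClass.comap_eq_comap_of_forall_eq_conj _ _ (localGLPiEquiv L 3 v T w) (fun g => ?_) _).symm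
  change localGLPiEquiv L 3 v (T * g.val * T⁻¹) w =
    localGLPiEquiv L 3 v T w * localGLPiEquiv L 3 v g.val w * (localGLPiEquiv L 3 v T w)⁻¹
  rw [map_mul, map_mul, map_inv]
  rfl

/-! ## §2 The `Δ‴`-weighted orbital sums across the frame at a split place -/

variable [∀ γ : (UnitaryGroup.cmDatum L 3 H).Local v, MeasurableSpace ((UnitaryGroup.cmDatum L 3 H).Local v ⧸ Subgroup.centralizer ({γ} : Set ((UnitaryGroup.cmDatum L 3 H).Local v)))]
  [∀ γ : (UnitaryGroup.cmDatum L 3 H).Local v, BorelSpace ((UnitaryGroup.cmDatum L 3 H).Local v ⧸ Subgroup.centralizer ({γ} : Set ((UnitaryGroup.cmDatum L 3 H).Local v)))]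
  [∀ γ : (UnitaryGroup.cmDatum L 3 (Matrix.of fun i j : Fin 3 => if i.val + j.val + 1 = 3 then (1 : L) else 0)).Local v,
    MeasurableSpace ((UnitaryGroup.cmDatum L 3 (Matrix.of fun i j : Fin 3 => if i.val + j.val + 1 = 3 then (1 : L) else 0)).Local v ⧸
      Subgroup.centralizer ({γ} : Set ((UnitaryGroup.cmDatum L 3 (Matrix.of fun i j : Fin 3 => if i.val + j.val + 1 = 3 then (1 : L) else 0)).Local v)))]
  [∀ γ : (UnitaryGroup.cmDatum L 3 (Matrix.of fun i j : Fin 3 => if i.val + j.val + 1 = 3 then (1 : L) else 0)).Local v,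
    BorelSpace ((UnitaryGroup.cmDatum L 3 (Matrix.of fun i j : Fin 3 => if i.val + j.val + 1 = 3 then (1 : L) else 0)).Local v ⧸
      Subgroup.centralizer ({γ} : Set ((UnitaryGroup.cmDatum L 3 (Matrix.of fun i j : Fin 3 => if i.val + j.val + 1 = 3 then (1 : L) else 0)).Local v)))]

include h in
open scoped Classical in
/-- **The `Δ‴`-weighted orbital sums transport along `e` at a split place, with NO factor**:
`Σᶠ_{c ∈ Cl U(Φ₃)_v} Δ‴_v^{Φ₃}(γ_H, out c)·Φ(c, g ∘ e; e⁻¹_* m_G) = Σᶠ_{c′ ∈ Cl U(H)_v} Δ‴_v^{H}(γ_H, out c′)·Φ(c′, g; m_G)` — reindex along `c ↦ e(c)` (★ `preClass`), orbital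
integrals transport exactly (★ `classOrbitalIntegral_transport`), `Δ‴(γ_H, ·)` is a class function (★ `finExplicitDelta_conj_right_all`) and §1.
[cite: Rogawski1990, §4.3 (4.3.1) p. 43; §14.2 p. 232] -/
theorem finsum_finExplicitDelta_mul_classOrbitalIntegral_transport_of_split (hs : ∃ w : PlacesOver L v, IsCMField.complexConj L • w.1 ≠ w.1)
    (μ : HeckeCharacter L) (mG : OrbitalMeasureFamily ((UnitaryGroup.cmDatum L 3 H).Local v)) (g : (UnitaryGroup.cmDatum L 3 H).Local v → ℂ)
    (γH : (UnitaryGroup.cmDatum L 2 (Matrix.of fun i j : Fin 2 => if i.val + j.val + 1 = 2 then (1 : L) else 0)).Local v ×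
      (UnitaryGroup.cmDatum L 1 (Matrix.of fun i j : Fin 1 => if i.val + j.val + 1 = 1 then (1 : L) else 0)).Local v)
    (hu : IsUnit ((finCharpolyTwo L v γH).eval (finGammaTwo L v γH))) :
    (∑ᶠ c : ConjClasses ((UnitaryGroup.cmDatum L 3 (Matrix.of fun i j : Fin 3 => if i.val + j.val + 1 = 3 then (1 : L) else 0)).Local v),
        finExplicitDelta L v (Matrix.of fun i j : Fin 3 => if i.val + j.val + 1 = 3 then (1 : L) else 0) γH μ (Quotient.out c) *
          classOrbitalIntegral
            (mG.transport (cmDatumLocalCongr L v T ha h).symm.toMulEquiv (cmDatumLocalCongr L v T ha h).symm.continuous (cmDatumLocalCongr L v T ha h).continuous)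
            (g ∘ cmDatumLocalCongr L v T ha h) c) =
      ∑ᶠ c : ConjClasses ((UnitaryGroup.cmDatum L 3 H).Local v), finExplicitDelta L v H γH μ (Quotient.out c) * classOrbitalIntegral mG g c := by
  classical
  set ψ : (UnitaryGroup.cmDatum L 3 H).Local v ≃* (UnitaryGroup.cmDatum L 3 (Matrix.of fun i j : Fin 3 => if i.val + j.val + 1 = 3 then (1 : L) else 0)).Local v :=
    (cmDatumLocalCongr L v T ha h).symm.toMulEquiv with hψ
  -- `c ↦ e(c)` is a bijection on conjugacy classes
  have hbij : Function.Bijective (fun c : ConjClasses ((UnitaryGroup.cmDatum L 3 (Matrix.of fun i j : Fin 3 => if i.val + j.val + 1 = 3 then (1 : L) else 0)).Local v) =>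
      preClass ψ c) := by
    refine ⟨fun c₁ c₂ h12 => ?_, fun c' => ⟨c'.map ψ.toMonoidHom, preClass_map ψ c'⟩⟩
    have h' : preClass ψ c₁ = preClass ψ c₂ := h12
    rw [← map_preClass ψ c₁, ← map_preClass ψ c₂, h']
  refine finsum_eq_of_bijective (fun c => preClass ψ c) hbij fun c => ?_
  -- orbital integrals transport exactly; `(g ∘ e) ∘ e⁻¹ = g`
  have hf : (g ∘ (cmDatumLocalCongr L v T ha h)) ∘ ψ = g := by
    funext b
    show g ((cmDatumLocalCongr L v T ha h) ((cmDatumLocalCongr L v T ha h).symm b)) = g b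
    rw [ContinuousMulEquiv.apply_symm_apply]
  rw [classOrbitalIntegral_transport, hf]
  -- `Δ‴(γ_H, out c) = Δ‴(γ_H, e⁻¹ (out (e c)))` (conjugate) `= Δ‴^{H}(γ_H, out (e c))`
  obtain ⟨y, hy⟩ := isConj_iff.1 (isConj_apply_out_preClass ψ c)
  rw [← hy, finExplicitDelta_conj_right_all L (Matrix.of fun i j : Fin 3 => if i.val + j.val + 1 = 3 then (1 : L) else 0) μ v γH _ y,
    show ψ (Quotient.out (preClass ψ c)) = (cmDatumLocalCongr L v T ha h).symm (Quotient.out (preClass ψ c)) from rfl,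
    finExplicitDelta_cmDatumLocalCongr_symm_of_split L H v T ha h hs μ γH hu]

/-! ## §3 (4.3.1) across the frame at a split place -/

variable
  [∀ a' : (UnitaryGroup.cmDatum L 2 (Matrix.of fun i j : Fin 2 => if i.val + j.val + 1 = 2 then (1 : L) else 0)).Local v ×
      (UnitaryGroup.cmDatum L 1 (Matrix.of fun i j : Fin 1 => if i.val + j.val + 1 = 1 then (1 : L) else 0)).Local v,
    MeasurableSpace (((UnitaryGroup.cmDatum L 2 (Matrix.of fun i j : Fin 2 => if i.val + j.val + 1 = 2 then (1 : L) else 0)).Local v ×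
        (UnitaryGroup.cmDatum L 1 (Matrix.of fun i j : Fin 1 => if i.val + j.val + 1 = 1 then (1 : L) else 0)).Local v) ⧸
      Subgroup.centralizer ({a'} : Set ((UnitaryGroup.cmDatum L 2 (Matrix.of fun i j : Fin 2 => if i.val + j.val + 1 = 2 then (1 : L) else 0)).Local v ×
        (UnitaryGroup.cmDatum L 1 (Matrix.of fun i j : Fin 1 => if i.val + j.val + 1 = 1 then (1 : L) else 0)).Local v)))]

include h in
open scoped Classical in
/-- **`(f^H, f)` is `Δ‴_H`-matched iff `(f^H, f ∘ e)` is `Δ‴_{Φ₃}`-matched for the transported family `e⁻¹_* m_G`, AT A SPLIT PLACE** (no sign: §2; `χ_g(u)` is a unit at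
`G`-regular `γ_H`, ★ `isUnit_eval_finCharpolyTwo_of_isLocalGRegular`).  The split twin of ★ `F0P3cStCharTSOfQuasiSplit.isLocalDeltaTransfer_iff_of_formCongr`.
[cite: Rogawski1990, §4.3 (4.3.1) p. 43; §14.2 p. 232] -/
theorem isLocalDeltaTransfer_iff_of_formCongr_of_split (hs : ∃ w : PlacesOver L v, IsCMField.complexConj L • w.1 ≠ w.1) (μ : HeckeCharacter L)
    (mHv : OrbitalMeasureFamily ((UnitaryGroup.cmDatum L 2 (Matrix.of fun i j : Fin 2 => if i.val + j.val + 1 = 2 then (1 : L) else 0)).Local v ×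
      (UnitaryGroup.cmDatum L 1 (Matrix.of fun i j : Fin 1 => if i.val + j.val + 1 = 1 then (1 : L) else 0)).Local v))
    (mGv : OrbitalMeasureFamily ((UnitaryGroup.cmDatum L 3 H).Local v))
    (fH : (UnitaryGroup.cmDatum L 2 (Matrix.of fun i j : Fin 2 => if i.val + j.val + 1 = 2 then (1 : L) else 0)).Local v ×
      (UnitaryGroup.cmDatum L 1 (Matrix.of fun i j : Fin 1 => if i.val + j.val + 1 = 1 then (1 : L) else 0)).Local v → ℂ)
    (f : (UnitaryGroup.cmDatum L 3 H).Local v → ℂ) :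
    IsLocalDeltaTransfer L H v ((finExplicitCollection L H μ (finExplicitDelta_conj_left_all L H μ) (finExplicitDelta_conj_right_all L H μ)) v) mHv mGv fH f ↔
      IsLocalDeltaTransfer L (Matrix.of fun i j : Fin 3 => if i.val + j.val + 1 = 3 then (1 : L) else 0) v
        ((finExplicitCollection L (Matrix.of fun i j : Fin 3 => if i.val + j.val + 1 = 3 then (1 : L) else 0) μ
          (finExplicitDelta_conj_left_all L (Matrix.of fun i j : Fin 3 => if i.val + j.val + 1 = 3 then (1 : L) else 0) μ)
          (finExplicitDelta_conj_right_all L (Matrix.of fun i j : Fin 3 => if i.val + j.val + 1 = 3 then (1 : L) else 0) μ)) v) mHv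
        (mGv.transport (cmDatumLocalCongr L v T ha h).symm.toMulEquiv (cmDatumLocalCongr L v T ha h).symm.continuous (cmDatumLocalCongr L v T ha h).continuous)
        fH (f ∘ (cmDatumLocalCongr L v T ha h)) := by
  rw [isLocalDeltaTransfer_iff, isLocalDeltaTransfer_iff]
  refine forall_congr' fun γH => forall_congr' fun hreg => ?_
  simp only [finExplicitCollection_Δ_eq]
  rw [finsum_finExplicitDelta_mul_classOrbitalIntegral_transport_of_split L H v T ha h hs μ mGv f γH
    (isUnit_eval_finCharpolyTwo_of_isLocalGRegular L v γH hreg)]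

/-! ## §4 The split packet and the split letter ride the frame -/

variable [MeasurableSpace ((UnitaryGroup.cmDatum L 3 H).Local v)] [BorelSpace ((UnitaryGroup.cmDatum L 3 H).Local v)]
  [MeasurableSpace ((UnitaryGroup.cmDatum L 3 (Matrix.of fun i j : Fin 3 => if i.val + j.val + 1 = 3 then (1 : L) else 0)).Local v)]
  [BorelSpace ((UnitaryGroup.cmDatum L 3 (Matrix.of fun i j : Fin 3 => if i.val + j.val + 1 = 3 then (1 : L) else 0)).Local v)]
  [MeasurableSpace ((UnitaryGroup.cmDatum L 2 (Matrix.of fun i j : Fin 2 => if i.val + j.val + 1 = 2 then (1 : L) else 0)).Local v ×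
    (UnitaryGroup.cmDatum L 1 (Matrix.of fun i j : Fin 1 => if i.val + j.val + 1 = 1 then (1 : L) else 0)).Local v)]

include h in
open scoped Classical in
set_option synthInstance.maxHeartbeats 400000 in
set_option maxHeartbeats 4000000 in
/-- **A ONE-MEMBER packet's Test identity rides the frame at a split place**: if `⟨πⁿ, none⟩` satisfies (13.1.4)∕(4.13.1 (b)) on test functions on `U(H)_v` at
`D = (Δ‴_H, m_H, m_G, ν_G, ν_H, ξ_v)`, then `⟨πⁿ ∘ e, none⟩` satisfies it on `U(Φ₃)_v` at `D₀ = (Δ‴_{Φ₃}, m_H, e⁻¹_* m_G, e⁻¹_* ν_G, ν_H, ξ_v)` (§3 + ★ «TR»).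
[cite: Rogawski1990, §4.13 Lemma 4.13.1 (b) p. 63; §13.1 Prop. 13.1.4 p. 199; §14.2 p. 232] -/
theorem charIdentityAtTest_single_transport_formCongr_of_split (hs : ∃ w : PlacesOver L v, IsCMField.complexConj L • w.1 ≠ w.1) (μ : HeckeCharacter L)
    (hH : (H.map (cmConjRingHom L))ᵀ = H) (hHd : IsUnit H.det)
    (mHv : OrbitalMeasureFamily ((UnitaryGroup.cmDatum L 2 (Matrix.of fun i j : Fin 2 => if i.val + j.val + 1 = 2 then (1 : L) else 0)).Local v ×
      (UnitaryGroup.cmDatum L 1 (Matrix.of fun i j : Fin 1 => if i.val + j.val + 1 = 1 then (1 : L) else 0)).Local v))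
    (mGv : OrbitalMeasureFamily ((UnitaryGroup.cmDatum L 3 H).Local v))
    (νG : Measure ((UnitaryGroup.cmDatum L 3 H).Local v)) [νG.IsHaarMeasure]
    (νH : Measure ((UnitaryGroup.cmDatum L 2 (Matrix.of fun i j : Fin 2 => if i.val + j.val + 1 = 2 then (1 : L) else 0)).Local v ×
      (UnitaryGroup.cmDatum L 1 (Matrix.of fun i j : Fin 1 => if i.val + j.val + 1 = 1 then (1 : L) else 0)).Local v))
    (ξv : (UnitaryGroup.cmDatum L 2 (Matrix.of fun i j : Fin 2 => if i.val + j.val + 1 = 2 then (1 : L) else 0)).Local v ×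
      (UnitaryGroup.cmDatum L 1 (Matrix.of fun i j : Fin 1 => if i.val + j.val + 1 = 1 then (1 : L) else 0)).Local v →* ℂˣ)
    (πn : IrrClass ((UnitaryGroup.cmDatum L 3 H).Local v))
    (hid : (⟨πn, none⟩ : CMLocalAPacket L H v).CharIdentityAtTest L H v (fun c f => c.smoothTrace νG f) ξv νH
      ((finExplicitCollection L H μ (finExplicitDelta_conj_left_all L H μ) (finExplicitDelta_conj_right_all L H μ)) v) mHv mGv) :
    (⟨IrrClass.comap (cmDatumLocalCongr L v T ha h) πn, none⟩ :
        CMLocalAPacket L (Matrix.of fun i j : Fin 3 => if i.val + j.val + 1 = 3 then (1 : L) else 0) v).CharIdentityAtTest L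
      (Matrix.of fun i j : Fin 3 => if i.val + j.val + 1 = 3 then (1 : L) else 0) v
      (fun c f => c.smoothTrace (νG.map (cmDatumLocalCongr L v T ha h).symm) f) ξv νH
      ((finExplicitCollection L (Matrix.of fun i j : Fin 3 => if i.val + j.val + 1 = 3 then (1 : L) else 0) μ
        (finExplicitDelta_conj_left_all L (Matrix.of fun i j : Fin 3 => if i.val + j.val + 1 = 3 then (1 : L) else 0) μ)
        (finExplicitDelta_conj_right_all L (Matrix.of fun i j : Fin 3 => if i.val + j.val + 1 = 3 then (1 : L) else 0) μ)) v) mHv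
      (mGv.transport (cmDatumLocalCongr L v T ha h).symm.toMulEquiv (cmDatumLocalCongr L v T ha h).symm.continuous (cmDatumLocalCongr L v T ha h).continuous) := by
  set e := cmDatumLocalCongr L v T ha h with he_def
  rw [LocalAPacket.charIdentityAtTest_single_iff] at hid ⊢
  intro gH φ hgH hφ hmQ
  have hf : IsLocSmooth (φ ∘ e.symm) := F0P3cStCharTSTransport.isLocSmooth_comp_continuousMulEquiv e.symm hφ
  have hφe : (φ ∘ e.symm) ∘ e = φ := by
    funext q
    simp only [Function.comp_apply, ContinuousMulEquiv.symm_apply_apply]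
  have hmG : IsLocalDeltaTransfer L H v ((finExplicitCollection L H μ (finExplicitDelta_conj_left_all L H μ) (finExplicitDelta_conj_right_all L H μ)) v)
      mHv mGv gH (φ ∘ e.symm) := by
    rw [isLocalDeltaTransfer_iff_of_formCongr_of_split L H v T ha h hs μ mHv mGv gH (φ ∘ e.symm), hφe]
    exact hmQ
  have key := hid gH (φ ∘ e.symm) hgH hf hmG
  have hadm : πn.IsAdmissible := F0P3LocalIrrepAdmissibleThree.localIrrepAdmissible_three_all L H hH hHd v πn
  rw [← smoothTrace_comap_map_symm e πn hadm νG φ] at key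
  exact key

include h in
open scoped Classical in
set_option synthInstance.maxHeartbeats 400000 in
set_option maxHeartbeats 4000000 in
/-- **(B3d, d3-split) THE SPLIT CONJUNCT OF THE Q-PACKAGE RIDES A FORM CONGRUENCE TO THE QUASI-SPLIT MODEL.**  At a place `v` SPLIT in `L` (`w ∣ v`, `w̄ ≠ w`), for a
hermitian `H` with unit determinant and a frame `ᵗ(σT)·H_v·T = a·Φ₃` (`e := cmDatumLocalCongr L v T ha h`): the split letter ★ `CMSplitCharIdentityAtTest` for `H` at
`D = (Δ‴_H, m_H, m_G, ν_G, ν_H, ξ_v)` and labels `(ν₀, χ′)` implies the split letter for `Φ₃` at the transported data `D₀ = (Δ‴_{Φ₃}, m_H, e⁻¹_* m_G, e⁻¹_* ν_G, ν_H, ξ_v)`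
and the SAME labels (the split packet rides, `cmSplitPacket_map_comap_cmDatumLocalCongr`; its one member's Test identity rides, `charIdentityAtTest_single_transport_formCongr_of_split`).
[cite: Rogawski1990, §4.13 Lemma 4.13.1 (b) p. 63; §13.1 Prop. 13.1.4 p. 199; §13.3 p. 201; §14.2 pp. 232–234] -/
theorem cmSplitCharIdentityAtTest_transport_formCongr (μ : HeckeCharacter L) (hH : (H.map (cmConjRingHom L))ᵀ = H) (hHd : IsUnit H.det)
    (w : PlacesOver L v) (hw : IsCMField.complexConj L • w.1 ≠ w.1)
    [LocallyCompactSpace (standardParabolicGL (w.1.adicCompletion L) (Zelevinsky1980.lastBlockLabel 3))]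
    (ν₀ χ' : (w.1.adicCompletion L)ˣ →* ℂˣ) (hν₀u : ∀ x, ‖((ν₀ x : ℂˣ) : ℂ)‖ = 1)
    (hν₀c : Continuous fun x => ((ν₀ x : ℂˣ) : ℂ)) (hχ'u : ∀ x, ‖((χ' x : ℂˣ) : ℂ)‖ = 1)
    (hχ'c : Continuous fun x => ((χ' x : ℂˣ) : ℂ))
    (mHv : OrbitalMeasureFamily ((UnitaryGroup.cmDatum L 2 (Matrix.of fun i j : Fin 2 => if i.val + j.val + 1 = 2 then (1 : L) else 0)).Local v ×
      (UnitaryGroup.cmDatum L 1 (Matrix.of fun i j : Fin 1 => if i.val + j.val + 1 = 1 then (1 : L) else 0)).Local v))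
    (mGv : OrbitalMeasureFamily ((UnitaryGroup.cmDatum L 3 H).Local v))
    (νG : Measure ((UnitaryGroup.cmDatum L 3 H).Local v)) [νG.IsHaarMeasure]
    (νH : Measure ((UnitaryGroup.cmDatum L 2 (Matrix.of fun i j : Fin 2 => if i.val + j.val + 1 = 2 then (1 : L) else 0)).Local v ×
      (UnitaryGroup.cmDatum L 1 (Matrix.of fun i j : Fin 1 => if i.val + j.val + 1 = 1 then (1 : L) else 0)).Local v))
    (ξv : (UnitaryGroup.cmDatum L 2 (Matrix.of fun i j : Fin 2 => if i.val + j.val + 1 = 2 then (1 : L) else 0)).Local v ×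
      (UnitaryGroup.cmDatum L 1 (Matrix.of fun i j : Fin 1 => if i.val + j.val + 1 = 1 then (1 : L) else 0)).Local v →* ℂˣ)
    (hId : CMSplitCharIdentityAtTest L v H hH hHd w hw ν₀ χ' hν₀u hν₀c hχ'u hχ'c
      ((finExplicitCollection L H μ (finExplicitDelta_conj_left_all L H μ) (finExplicitDelta_conj_right_all L H μ)) v) mHv mGv νG νH ξv) :
    CMSplitCharIdentityAtTest L v (Matrix.of fun i j : Fin 3 => if i.val + j.val + 1 = 3 then (1 : L) else 0) (antidiagOne_isHermitian L 3)
      (isUnit_antidiagOne_det L 3) w hw ν₀ χ' hν₀u hν₀c hχ'u hχ'c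
      ((finExplicitCollection L (Matrix.of fun i j : Fin 3 => if i.val + j.val + 1 = 3 then (1 : L) else 0) μ
        (finExplicitDelta_conj_left_all L (Matrix.of fun i j : Fin 3 => if i.val + j.val + 1 = 3 then (1 : L) else 0) μ)
        (finExplicitDelta_conj_right_all L (Matrix.of fun i j : Fin 3 => if i.val + j.val + 1 = 3 then (1 : L) else 0) μ)) v) mHv
      (mGv.transport (cmDatumLocalCongr L v T ha h).symm.toMulEquiv (cmDatumLocalCongr L v T ha h).symm.continuous (cmDatumLocalCongr L v T ha h).continuous)
      (νG.map (cmDatumLocalCongr L v T ha h).symm) νH ξv := by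
  rw [cmSplitCharIdentityAtTest_iff] at hId ⊢
  rw [← cmSplitPacket_map_comap_cmDatumLocalCongr L H v T ha h hH hHd w hw ν₀ χ' hν₀u hν₀c hχ'u hχ'c]
  exact charIdentityAtTest_single_transport_formCongr_of_split L H v T ha h ⟨w, hw⟩ μ hH hHd mHv mGv νG νH ξv _ hId

end Split

end Summit.HodgeConjecture.HodgeConjecture.R90.S9

end
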